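import Literature.AnabelianGeometry.SemiGraphs.SubdivisionFolding
import Literature.AnabelianGeometry.SemiGraphs.TemperedLevelData
import Literature.AnabelianGeometry.SemiGraphs.FreeGroupsAndActionsProofs2
import HarnessLib

/-!
# [SemiAnbd] Thm 3.7 (iii) beyond finite `𝔾`: the binder `hbdd` from LOCAL level-estrangement

Mochizuki, *Semi-graphs of anabelioids*, Publ. RIMS **42** (2006), §3, Theorem 3.7 (iii), manuscript
p. 41 ("if `H` fixes two vertices of `𝒢_{∞,j}`, then these two vertices are joined to one another by a
single edge"), with the author's *Comments* (2020) (6)(b) [cite: MochizukiSemiAnbd2006, Thm 3.7(iii) p.41].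

PROOF-ONLY (cell abc-iut, layer L3, GAP row G-t6g3-2b «no escape», binder `hbdd` of
`compactInVerticialAt_of_noEscape` (abc-iut-L3-t10); seat abc-iut-w6-d062, brick B3 of the desk memo
HOME/staging/w6/w6-d062/HBDD-LOCFIN-memo.md).  Over an ABSTRACT `D : VerticialLevelData 𝒢 c` and ANY
subgroup `C ≤ π₁^temp(𝒢)`, the LOCALISED level-estrangement hypothesis

  (LE_C,w) for every base vertex `w` of `𝔾` and every level `j` there is a level `k ≥ j` such that at
  every level `k' ≥ k`, at every tree vertex `v` of `𝒢_{∞,k'}` LYING OVER `w`, two `C`-fixed edges of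
  distinct branches at `v` have the SAME image in `𝒢_{∞,j}`

— per base vertex, NOT uniform over `𝔾`: it is what total estrangement yields at a vertex of FINITE
VALENCE by compactness of `Π_w` (the memo's depth lemma §2, group-theoretic core landed as
`Literature/GroupTheory/EstrangementDepth.lean`), whereas the UNIFORM version (UE_C) of
`TemperedFixedSystemsOfUniformEstrangement.lean` (abc-iut-w6-d088) / (hno∞) of
`TemperedEdgeImagesOfNoUnfoldedSubjoint.lean` (abc-iut-w5-d212) fails along the escaping ray of the
countermodel `𝒢_θ` — already gives the SECOND «no escape» bound:

* `VerticialLevelData.dist_le_four_of_localLevelEstranged` — two compatible `C`-fixed vertex systems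
  `x`, `x'` satisfy `dist (x_j, x'_j) ≤ 4` in the barycentric subdivision of EVERY `𝒢_{∞,j}` (i.e. the
  vertices `x_j`, `x'_j` coincide or are the two ends of one edge): FOLDING (abc-iut-w6-d062's
  `SemiGraph.vertexMap_eq_or_eq_of_folding`, `SubdivisionFolding.lean`) along the `C`-fixed geodesic of a
  deep level `k'` chosen from (LE_C,u) at the base vertex `u` under `x` AND from (LE_C,w*) at the ONE
  neighbouring base vertex `w*` under the far end of the image edge `ε*` of the first fixed branch — the
  folding hypothesis is needed only at tree vertices mapping to the two ends of `ε*`, which lie over `u`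
  and `w*`;
* `VerticialLevelData.hbdd_of_localLevelEstranged` — the binder shape `∃ N, ∀ j, dist ≤ N` (with `N = 4`).

So, at a locally finite `𝔾`, the open core G-t6g3-2b is the EXISTENCE clause `hdisp` alone.  Nothing here
asserts (LE_C,w) for any `𝒢` (its tower-level derivation from `EstrangementDepth` is brick B1b of the
memo); nothing here bears on [IUTchIII] Cor. 3.12; typed ≠ proved elsewhere.
-/

namespace Literature.AnabelianGeometry.SemiGraphs

namespace ProfiniteSemiGraph

namespace VerticialLevelData

open CategoryTheory Topology

universe v u

variable {𝒢 : ProfiniteSemiGraph.{u}} {c : TemperedPiChart 𝒢} (D : VerticialLevelData.{v} 𝒢 c)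

/-- The first step of a walk of the subdivision between the points of two distinct vertices is a branch
abutting to the origin. [cite: MochizukiSemiAnbd2006, §1 pp.11-12] -/
private theorem exists_branch_mem_support {T : SemiGraph.{u}} {y y' : T.Vertex} (hne : y ≠ y')
    (p : T.subdivision.Walk (Sum.inl y) (Sum.inl y')) :
    ∃ β : T.Branch, T.abuts β = some y ∧ (Sum.inr (Sum.inr β) : T.Node) ∈ p.support := by
  cases p with
  | nil => exact (hne rfl).elim
  | cons h q =>
    obtain ⟨β, hβ, hq⟩ := (T.subdivision_adj_inl_iff y _).1 h
    subst hq
    exact ⟨β, hβ, by simp⟩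

/-- Base vertices along the transition maps: `proj_k (v) = proj_j (trans v)`.
[cite: MochizukiSemiAnbd2006, Thm 3.7(iii) p.41] -/
private theorem proj_vertexMap_eq_proj_trans ⦃j k : D.J⦄ (h : j ≤ k) (v : (D.tree k).Vertex) :
    (D.proj k).vertexMap v = (D.proj j).vertexMap ((D.trans h).vertexMap v) := by
  have e := congrArg (fun φ => SemiGraph.Hom.vertexMap φ v) (D.trans_over h)
  simpa only [SemiGraph.comp_vertexMap, Function.comp_apply] using e.symm

/-- **`hbdd` with bound `4` from LOCAL level-estrangement** ([SemiAnbd] Thm 3.7 (iii), second sentence,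
at an arbitrary countable `𝔾`): if for every base vertex `w` and level `j` there is a level from which
on, at tree vertices over `w`, two `C`-fixed edges of distinct branches at a common vertex have the same
level-`j` image, then two compatible `C`-fixed vertex systems are, at EVERY level, equal or the two ends
of one edge — subdivision distance `≤ 4`.  Proof: fold the `C`-fixed geodesic of a deep level along the
transition map (`SemiGraph.vertexMap_eq_or_eq_of_folding`); the hypothesis is used at the base vertex
`u` under `x` and at the one base vertex `w*` under the far end of the image `ε*` of the first fixed
branch at `x` (stable in the level by the hypothesis at `u`). [cite: MochizukiSemiAnbd2006, Thm 3.7(iii) p.41] -/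
theorem dist_le_four_of_localLevelEstranged (C : Subgroup c.G)
    (hLE : ∀ (w : 𝒢.graph.Vertex) (j : D.J), ∃ (k : D.J) (hjk : j ≤ k), ∀ (k' : D.J) (hkk' : k ≤ k')
      (v : (D.tree k').Vertex), (D.proj k').vertexMap v = w →
      ∀ (b b' : (D.tree k').Branch), (D.tree k').abuts b = some v → (D.tree k').abuts b' = some v →
      (D.tree k').edgeOf b ≠ (D.tree k').edgeOf b' →
      (∀ g ∈ C, (D.act k' g).hom.edgeMap ((D.tree k').edgeOf b) = (D.tree k').edgeOf b) →
      (∀ g ∈ C, (D.act k' g).hom.edgeMap ((D.tree k').edgeOf b') = (D.tree k').edgeOf b') →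
      (D.trans (hjk.trans hkk')).edgeMap ((D.tree k').edgeOf b) =
        (D.trans (hjk.trans hkk')).edgeMap ((D.tree k').edgeOf b'))
    (x x' : ∀ j, (D.tree j).Vertex)
    (hx : ∀ ⦃i j : D.J⦄ (h : i ≤ j), (D.trans h).vertexMap (x j) = x i)
    (hx' : ∀ ⦃i j : D.J⦄ (h : i ≤ j), (D.trans h).vertexMap (x' j) = x' i)
    (hfx : ∀ g ∈ C, ∀ j, (D.act j g).hom.vertexMap (x j) = x j)
    (hfx' : ∀ g ∈ C, ∀ j, (D.act j g).hom.vertexMap (x' j) = x' j) (j : D.J) :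
    (D.tree j).subdivision.dist (Sum.inl (x j)) (Sum.inl (x' j)) ≤ 4 := by
  classical
  -- the `C`-fixed points of the subdivision of a level, and the `C`-fixed geodesic between `x k`, `x' k`
  let F : ∀ k : D.J, Set (D.tree k).Node := fun k => {z | ∀ g ∈ C, SemiGraph.nodeMap (D.act k g) z = z}
  have hpath : ∀ k : D.J, ∃ p : (D.tree k).subdivision.Walk (Sum.inl (x k)) (Sum.inl (x' k)),
      ∀ z ∈ p.support, z ∈ F k := by
    intro k
    have hT := (D.isTree k).isTree
    let p : (D.tree k).subdivision.Path (Sum.inl (x k)) (Sum.inl (x' k)) :=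
      (hT.connected (Sum.inl (x k)) (Sum.inl (x' k))).some.toPath
    refine ⟨p.1, fun z hz g hg => ?_⟩
    have hxn : SemiGraph.nodeMap (D.act k g) (Sum.inl (x k)) = Sum.inl (x k) := by simp [hfx g hg k]
    have hx'n : SemiGraph.nodeMap (D.act k g) (Sum.inl (x' k)) = Sum.inl (x' k) := by simp [hfx' g hg k]
    exact SemiGraph.nodeMap_eq_self_of_isPath hT.isAcyclic _ hxn hx'n p.1 p.2 z hz
  -- fixed branch-points have fixed edges; fixed vertex-points are fixed vertices
  have hFedge : ∀ (k : D.J) (β : (D.tree k).Branch), (Sum.inr (Sum.inr β) : (D.tree k).Node) ∈ F k →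
      ∀ g ∈ C, (D.act k g).hom.edgeMap ((D.tree k).edgeOf β) = (D.tree k).edgeOf β := by
    intro k β hβ g hg
    have h := hβ g hg
    simp only [SemiGraph.nodeMap_inr_inr, Sum.inr.injEq] at h
    rw [← (D.act k g).hom.edgeOf_branchMap β, h]
  -- the base vertex under `x`
  set u : 𝒢.graph.Vertex := (D.proj j).vertexMap (x j) with hu
  have hxu : ∀ (k : D.J) (h : j ≤ k), (D.proj k).vertexMap (x k) = u := fun k h => by
    rw [D.proj_vertexMap_eq_proj_trans h, hx h]
  -- level `k₁` from (LE) at `u`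
  obtain ⟨k₁, hjk₁, h₁⟩ := hLE u j
  by_cases heq₁ : x k₁ = x' k₁
  · have hxj : x j = x' j := by rw [← hx hjk₁, ← hx' hjk₁, heq₁]
    rw [hxj, SimpleGraph.dist_self]; exact Nat.zero_le _
  -- the first fixed branch `β₁` at `x k₁`, its image edge `ε*` at level `j`, the far end `a'` over `w*`
  obtain ⟨p₁, hp₁⟩ := hpath k₁
  obtain ⟨β₁, hβ₁, hβ₁F⟩ := exists_branch_mem_support heq₁ p₁
  set ε : (D.tree j).Edge := (D.trans hjk₁).edgeMap ((D.tree k₁).edgeOf β₁) with hε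
  have hc₀ε : (D.tree j).edgeOf ((D.trans hjk₁).branchMap β₁) = ε := (D.trans hjk₁).edgeOf_branchMap β₁
  have hc₀a : (D.tree j).abuts ((D.trans hjk₁).branchMap β₁) = some (x j) := by
    rw [(D.trans hjk₁).abuts_branchMap β₁ _ hβ₁, hx hjk₁]
  obtain ⟨a', hends, hdist⟩ := SemiGraph.exists_ends_dist_le_four ε _ hc₀ε hc₀a
  set w : 𝒢.graph.Vertex := (D.proj j).vertexMap a' with hw
  -- level `k'` beyond `k₁` and beyond the (LE)-level at `w*`
  obtain ⟨k₂, hjk₂, h₂⟩ := hLE w j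
  obtain ⟨k', hk₁k', hk₂k'⟩ := exists_ge_ge k₁ k₂
  have hjk' : j ≤ k' := hjk₁.trans hk₁k'
  have hne' : x k' ≠ x' k' := fun h => heq₁ (by rw [← hx hk₁k', ← hx' hk₁k', h])
  obtain ⟨p', hp'⟩ := hpath k'
  obtain ⟨β', hβ', hβ'F⟩ := exists_branch_mem_support hne' p'
  -- the first fixed branch at level `k'` still maps to `ε*` (by (LE) at `u`, level `k₁`)
  have hβ'ε : (D.trans hjk').edgeMap ((D.tree k').edgeOf β') = ε := by
    -- its image at level `k₁` is a `C`-fixed edge of a branch at `x k₁`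
    have himg : (D.trans hjk').edgeMap ((D.tree k').edgeOf β') =
        (D.trans hjk₁).edgeMap ((D.tree k₁).edgeOf ((D.trans hk₁k').branchMap β')) := by
      rw [(D.trans hk₁k').edgeOf_branchMap,
        show D.trans hjk' = D.trans hk₁k' ≫ D.trans hjk₁ from (D.trans_comp hjk₁ hk₁k').symm,
        SemiGraph.comp_edgeMap, Function.comp_apply]
    rw [himg, hε]
    by_cases hee : (D.tree k₁).edgeOf ((D.trans hk₁k').branchMap β') = (D.tree k₁).edgeOf β₁
    · rw [hee]
    · have habut : (D.tree k₁).abuts ((D.trans hk₁k').branchMap β') = some (x k₁) := by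
        rw [(D.trans hk₁k').abuts_branchMap β' _ hβ', hx hk₁k']
      have hfix' : ∀ g ∈ C, (D.act k₁ g).hom.edgeMap ((D.tree k₁).edgeOf ((D.trans hk₁k').branchMap β')) =
          (D.tree k₁).edgeOf ((D.trans hk₁k').branchMap β') := by
        intro g hg
        rw [(D.trans hk₁k').edgeOf_branchMap, ← D.trans_act_edgeMap hk₁k' g, hFedge k' β' (hp' _ hβ'F) g hg]
      have key := h₁ k₁ le_rfl (x k₁) (hxu k₁ hjk₁) _ _ habut hβ₁ hee hfix' (hFedge k₁ β₁ (hp₁ _ hβ₁F))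
      simpa using key
  -- FOLD at level `k'` along the transition to level `j`
  have hfold := SemiGraph.vertexMap_eq_or_eq_of_folding (D.trans hjk') (F k') hends ?_ p' hp'
    (Or.inl (hx hjk')) β' (hp' _ hβ'F) hβ' hβ'ε
  · -- conclusion: `x' j ∈ {x j, a'}`
    rw [hx' hjk'] at hfold
    rcases hfold with h | h
    · rw [h, SimpleGraph.dist_self]; exact Nat.zero_le _
    · rw [h]; exact hdist
  · -- the folding hypothesis at tree vertices mapping to `x j` (over `u`) or to `a'` (over `w*`)
    intro v hvF hv β β'' hβF hβ''F hβv hβ''v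
    by_cases hee : (D.tree k').edgeOf β = (D.tree k').edgeOf β''
    · rw [hee]
    rcases hv with hv | hv
    · -- over `u`: (LE) at `u`, level `k' ≥ k₁`
      have hvu : (D.proj k').vertexMap v = u := by rw [D.proj_vertexMap_eq_proj_trans hjk', hv]
      have key := h₁ k' hk₁k' v hvu β β'' hβv hβ''v hee (hFedge k' β hβF) (hFedge k' β'' hβ''F)
      simpa using key
    · -- over `w*`: (LE) at `w*`, level `k' ≥ k₂`
      have hvw : (D.proj k').vertexMap v = w := by rw [D.proj_vertexMap_eq_proj_trans hjk', hv]
      have key := h₂ k' hk₂k' v hvw β β'' hβv hβ''v hee (hFedge k' β hβF) (hFedge k' β'' hβ''F)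
      simpa using key

/-- **The binder `hbdd` of `compactInVerticialAt_of_noEscape` from LOCAL level-estrangement**: under
(LE_C,w) for every base vertex `w`, any two compatible `C`-fixed vertex systems stay at bounded
subdivision distance (`N = 4`). [cite: MochizukiSemiAnbd2006, Thm 3.7(iii) p.41] -/
theorem hbdd_of_localLevelEstranged (C : Subgroup c.G)
    (hLE : ∀ (w : 𝒢.graph.Vertex) (j : D.J), ∃ (k : D.J) (hjk : j ≤ k), ∀ (k' : D.J) (hkk' : k ≤ k')
      (v : (D.tree k').Vertex), (D.proj k').vertexMap v = w →
      ∀ (b b' : (D.tree k').Branch), (D.tree k').abuts b = some v → (D.tree k').abuts b' = some v →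
      (D.tree k').edgeOf b ≠ (D.tree k').edgeOf b' →
      (∀ g ∈ C, (D.act k' g).hom.edgeMap ((D.tree k').edgeOf b) = (D.tree k').edgeOf b) →
      (∀ g ∈ C, (D.act k' g).hom.edgeMap ((D.tree k').edgeOf b') = (D.tree k').edgeOf b') →
      (D.trans (hjk.trans hkk')).edgeMap ((D.tree k').edgeOf b) =
        (D.trans (hjk.trans hkk')).edgeMap ((D.tree k').edgeOf b'))
    (x x' : ∀ j, (D.tree j).Vertex)
    (hx : ∀ ⦃i j : D.J⦄ (h : i ≤ j), (D.trans h).vertexMap (x j) = x i)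
    (hx' : ∀ ⦃i j : D.J⦄ (h : i ≤ j), (D.trans h).vertexMap (x' j) = x' i)
    (hfx : ∀ g ∈ C, ∀ j, (D.act j g).hom.vertexMap (x j) = x j)
    (hfx' : ∀ g ∈ C, ∀ j, (D.act j g).hom.vertexMap (x' j) = x' j) :
    ∃ N : ℕ, ∀ j, (D.tree j).subdivision.dist (Sum.inl (x j)) (Sum.inl (x' j)) ≤ N :=
  ⟨4, D.dist_le_four_of_localLevelEstranged C hLE x x' hx hx' hfx hfx'⟩

end VerticialLevelData

end ProfiniteSemiGraph

end Literature.AnabelianGeometry.SemiGraphs
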